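import Literature.NumberTheory.GaloisCohomology.BrauerSumInvCyclicClass
import Literature.NumberTheory.GaloisCohomology.CyclicClassOfResEqZero
import Literature.NumberTheory.GaloisCohomology.CyclotomicTowerMuKilling
import Literature.NumberTheory.GaloisCohomology.LocalInvariantMapLevelChange
import Literature.NumberTheory.GaloisCohomology.PoitouTatePrimaryReduction
import Literature.NumberTheory.GaloisCohomology.CyclotomicKillingPrimePower
import Literature.NumberTheory.EllipticCurves.ZpExtensionLayerCharacter
import Literature.NumberTheory.EllipticCurves.IwasawaCyclotomicProofs
import HarnessLib

/-!
# Poitou–Tate `∑_v inv_v = 0` for a totally complex number field, modulo the correction at `p`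
# (Tate, Cassels–Fröhlich VII §9–§11; Milne, *ADT* I Thm. 4.10 (b)) — assembly (N6)

For a totally complex number field `K` this file ASSEMBLES the tree's discharge of the named fact
`poitouTate_sum_localTatePairing_eq_zero K` ("the sum of the local Tate pairings vanishes on global
classes", vendored in `PoitouTate.lean`) for THE invariant maps (`LocalInvariants.canonical K n`,
`ArchimedeanInvariantMap.lean`) from the landed nodes of the (F1) campaign, leaving exactly one input
as an explicit hypothesis — the **correction at `p`** (node T-pre, Tate VII §11 "pre-reduction"):

  `CorrectionAtP K p` (spelled out inline, no definition): every `y ∈ H²(Γ_K, μ_{p^{m+1}})` with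
  finitely supported local invariants can be replaced, after raising the level to some `p^e`, by a
  class `y'` which VANISHES AT THE PLACES ABOVE `p`, has finitely supported invariants, and whose
  invariant sums over large finite sets are `p^{e-m-1}` times those of `y` (the difference `y_e − y'`
  being a sum of auxiliary cyclic classes of `K(ζ_q)/K` whose invariant sums vanish).

**Theorem** (`sumInvLocalizationEqZero_canonical_primePow_of_correction`): granting the correction
at `p`, `(LocalInvariants.canonical K (p^(m+1))).SumInvLocalizationEqZero` for `K` totally complex.
Proof (Tate VII §10–§11): the complex places contribute `0` (`canonical_inl_eq_zero_of_isComplex`);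
for the finite places, correct `y ↦ y'`; kill `y'` on a layer `K_M` of the cyclotomic `ℤ_p`-extension
(`exists_resH_comap_span_pow_kummer_eq_zero`, Serre II §4.4); then `y' = κ(b) ∪ ψ_M` for the layer
character `ψ_M` (`exists_eq_cupProduct_δ₀_of_resH_eq_zero`, `ZpExtension.exists_cyclicCharacter_layer`);
the cyclotomic tower is unramified outside `p`, where `y'` vanishes, so the cyclic reciprocity law
`∑_v inv_v(κ(b) ∪ ψ_M) = 0` applies (`sum_localInvariantMap_localization_cupProduct_δ₀_eq_zero_of_isTotallyComplex`,
Tate VII §10); levels are moved with `LocalInvariantMapLevelChange.lean`.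

**Corollaries**: all levels `n` (`…_of_correction`, by `sumInvLocalizationEqZero_canonical_of_primePow`,
the primary decomposition of `PoitouTatePrimaryReduction.lean`) and the named fact
`poitouTate_sum_localTatePairing_eq_zero_of_isTotallyComplex_of_correction`
(`poitouTate_sum_localTatePairing_eq_zero_of_canonical`).  Theorems only; no named fact (D-0026);
the correction hypothesis is the statement announced for `BrauerClassCorrectionAtP.lean`.

## References

* J. Tate, *Global class field theory*, Ch. VII of Cassels–Fröhlich (1967), §9.6, §10, §11.
  [CasselsFrohlichANT1967]
* J. S. Milne, *Arithmetic Duality Theorems*, 2nd ed. (2006), I Thm. 4.10 (b), App. A. [MilneADT2006]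
* J.-P. Serre, *Cohomologie galoisienne* (1997), II §4.4. [SerreGaloisCohomology1997]
-/

noncomputable section

open CategoryTheory Function Field NumberField IsDedekindDomain
open scoped NumberField

namespace Literature.NumberTheory.GaloisCohomology

open _root_.ContinuousCohomology
open Literature.NumberTheory.GaloisRepresentations
open Literature.NumberTheory.GaloisRepresentations.DiscreteGaloisModule
open Literature.NumberTheory.GaloisRepresentations.LocalWeilDatum
open Literature.NumberTheory.EllipticCurves
open Literature.AnabelianGeometry.AbsoluteAnabelian
open Literature.AnabelianGeometry.AbsoluteAnabelian.Prop121vii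

variable (K : Type) [Field K] [NumberField K] [IsTotallyComplex K] (p : ℕ) [hp : Fact p.Prime]

/-- A multiple `x.val · p^(e-m-1)` read in `ℤ/p^e` vanishes only if `x = 0` (`x ∈ ℤ/p^(m+1)`,
`m + 1 ≤ e`). [folklore] -/
private theorem eq_zero_of_val_mul_pow_eq_zero {m e : ℕ} (hme : m + 1 ≤ e) (x : ZMod (p ^ (m + 1)))
    (h : ((x.val * p ^ (e - m - 1) : ℕ) : ZMod (p ^ e)) = 0) : x = 0 := by
  have hpp : p.Prime := hp.out
  rw [ZMod.natCast_eq_zero_iff] at h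
  have hlt : x.val * p ^ (e - m - 1) < p ^ e := by
    calc x.val * p ^ (e - m - 1) < p ^ (m + 1) * p ^ (e - m - 1) :=
          Nat.mul_lt_mul_of_lt_of_le (ZMod.val_lt x) le_rfl (pow_pos hpp.pos _)
      _ = p ^ e := by rw [← pow_add]; congr 1; omega
  have h0 : x.val * p ^ (e - m - 1) = 0 := Nat.eq_zero_of_dvd_of_lt h hlt
  rw [Nat.mul_eq_zero] at h0
  rcases h0 with h0 | h0
  · exact (ZMod.val_eq_zero x).mp h0
  · exact absurd h0 (pow_ne_zero _ hpp.ne_zero)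

set_option maxHeartbeats 800000 in
/-- **`∑_v inv_v = 0` on `H²(Γ_K, μ_{p^{m+1}})`, finite places, for `K` totally complex, granting
the correction at `p`** (Tate VII §10–§11; see the module docstring for the assembly).
[cite: CasselsFrohlichANT1967, Ch. VII §10–§11] [cite: MilneADT2006, Ch. I, Thm. 4.10(b)] -/
theorem sum_localInvariantMap_localization_eq_zero_of_correction (m : ℕ)
    (hpre : ∀ (y : galoisCohomology (mu K (p ^ (m + 1))) 2) (S : Finset (HeightOneSpectrum (𝓞 K))),
      (∀ v ∉ S, localInvariantMap K (p ^ (m + 1)) v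
        (galoisCohomology.localization (mu K (p ^ (m + 1))) (Sum.inr v) 2 y) = 0) →
      ∃ e : ℕ, m + 1 ≤ e ∧ ∃ (y' : galoisCohomology (mu K (p ^ e)) 2) (S' : Finset (HeightOneSpectrum (𝓞 K))),
        S ⊆ S' ∧
        (∀ v : HeightOneSpectrum (𝓞 K), (p : 𝓞 K) ∈ v.asIdeal →
          galoisCohomology.localization (mu K (p ^ e)) (Sum.inr v) 2 y' = 0) ∧
        (∀ v ∉ S', localInvariantMap K (p ^ e) v
          (galoisCohomology.localization (mu K (p ^ e)) (Sum.inr v) 2 y') = 0) ∧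
        (∀ T : Finset (HeightOneSpectrum (𝓞 K)), S' ⊆ T →
          ∑ v ∈ T, localInvariantMap K (p ^ e) v (galoisCohomology.localization (mu K (p ^ e)) (Sum.inr v) 2 y') =
            (((∑ v ∈ T, localInvariantMap K (p ^ (m + 1)) v
              (galoisCohomology.localization (mu K (p ^ (m + 1))) (Sum.inr v) 2 y)).val * p ^ (e - m - 1) : ℕ) :
              ZMod (p ^ e))))
    (y : galoisCohomology (mu K (p ^ (m + 1))) 2) (S : Finset (HeightOneSpectrum (𝓞 K)))
    (hS : ∀ v ∉ S, localInvariantMap K (p ^ (m + 1)) v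
      (galoisCohomology.localization (mu K (p ^ (m + 1))) (Sum.inr v) 2 y) = 0) :
    ∑ v ∈ S, localInvariantMap K (p ^ (m + 1)) v
      (galoisCohomology.localization (mu K (p ^ (m + 1))) (Sum.inr v) 2 y) = 0 := by
  classical
  have hpp : p.Prime := hp.out
  haveI : CompactSpace (absoluteGaloisGroup K) := absoluteGaloisGroup_compactSpace K
  obtain ⟨e, hme, y', S', hSS', hyp, hS', hsumT⟩ := hpre y S hS
  -- it suffices to treat `y'` over `S'`
  suffices hmain : ∑ v ∈ S', localInvariantMap K (p ^ e) v
      (galoisCohomology.localization (mu K (p ^ e)) (Sum.inr v) 2 y') = 0 by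
    have h1 := hsumT S' le_rfl
    rw [hmain] at h1
    have h2 := eq_zero_of_val_mul_pow_eq_zero p hme _ h1.symm
    rw [← h2]
    exact Finset.sum_subset hSS' fun v _ hv => hS v hv
  -- the cyclotomic `ℤ_p`-extension and the killing layer
  obtain ⟨κ, hκ⟩ := ZpExtension.exists_isCyclotomic_holds K p (GaloisRep.cyclotomicCharacter_range_infinite K p)
  have hS'0 : ∀ v ∉ S', galoisCohomology.localization (mu K (p ^ e)) (Sum.inr v) 2 y' = 0 := fun v hv =>
    (localInvariantMap_bijective (K := K) (n := p ^ e) v).1 (by rw [hS' v hv, map_zero])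
  obtain ⟨m₀, hm₀⟩ := exists_resH_comap_span_pow_kummer_eq_zero K κ.toContinuousMonoidHom
    (exists_apply_resGal_ne_one_of_isCyclotomic' K p hκ) (dvd_refl (p ^ e)) y' S' hS'0
  have hm₀' : resH (κ.layerSubgroup m₀) (units K) 2 ((cohomologyMap (kummerι K (p ^ e)) 2).hom y') = 0 := hm₀
  -- align the levels: `M ≥ m₀, e`; raise `y'` to level `p^M`
  set M : ℕ := max m₀ e with hMdef
  have heM : p ^ e ∣ p ^ M := pow_dvd_pow p (le_max_right _ _)
  set y'' : galoisCohomology (mu K (p ^ M)) 2 := cohomologyMap (muInclHom K heM) 2 y' with hy''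
  -- the Brauer class of `y''` dies on `Gal(K̄/K_M)`
  have hVle : κ.layerSubgroup M ≤ κ.layerSubgroup m₀ := κ.layerSubgroup_antitone (le_max_left _ _)
  have hkill : resH (κ.layerSubgroup M) (units K) 2 ((cohomologyMap (kummerι K (p ^ M)) 2).hom y'') = 0 := by
    have hK : (cohomologyMap (kummerι K (p ^ M)) 2).hom y'' = (cohomologyMap (kummerι K (p ^ e)) 2).hom y' := by
      rw [hy'']
      exact (map_comp_apply_of (ContinuousMonoidHom.id _) (ContinuousMonoidHom.id _) (ContinuousMonoidHom.id _)
        (fun _ => rfl) (resIdHom (muInclHom K heM)) (resIdHom (kummerι K (p ^ M)))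
        (resIdHom (kummerι K (p ^ e))) (fun _ => rfl) 2 y').symm
    rw [hK, resH_eq_resSub_resH (units K) hVle 2]
    change resSub (units K) hVle 2 (resH (κ.layerSubgroup m₀) (units K) 2 _) = 0
    rw [hm₀', map_zero]
  -- the layer character and the cyclic form of `y''`
  obtain ⟨ψ, hkerV, hkerL, -⟩ := κ.exists_cyclicCharacter_layer M
  haveI : FiniteDimensional K (κ.layer M) := κ.finiteDimensional_layer_holds M
  haveI : IsAbelianGalois K (κ.layer M) := κ.isAbelianGalois_layer M
  haveI : NumberField (κ.layer M) := NumberField.of_module_finite K (κ.layer M)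
  have hresψ : resH ψ.ker (units K) 2 ((cohomologyMap (kummerι K (p ^ M)) 2).hom y'') = 0 := by
    rw [hkerV]; exact hkill
  obtain ⟨b, hb⟩ := exists_eq_cupProduct_δ₀_of_resH_eq_zero ψ (κ.layer M) hkerL y'' hresψ
  -- the class `κ(b) ∪ ψ` vanishes wherever `ψ` is ramified (⊆ the places above `p`)
  have hram : ∀ v : HeightOneSpectrum (𝓞 K),
      (∃ σ ∈ absInertia (v.adicCompletion K), ψ (absGaloisRestrict K (v.adicCompletion K) σ) ≠ 0) →
      galoisCohomology.localization (mu K (p ^ M)) (Sum.inr v) 2 (((mu K (p ^ M)).tateDualPairing (p ^ M)).cupProduct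
        ((isSES_kummer K (p ^ M) (NeZero.pos _)).δ₀ (baseUnitsInvariant K (b : K) b.ne_zero))
        (oneCocycleClass _ (scalarCocycle ψ))) = 0 := by
    rintro v ⟨σ, hσ, hne⟩
    have hpv : (p : 𝓞 K) ∈ v.asIdeal := by
      by_contra hpv
      exact hne (hκ.apply_absGaloisRestrict_eq_zero_of_mem_absInertia hkerV hpv hσ)
    rw [← hb, hy'', localization_muInclHom_eq_zero_iff heM v y']
    exact hyp v hpv
  have hSψ : ∀ v ∉ S', localInvariantMap K (p ^ M) v (galoisCohomology.localization (mu K (p ^ M)) (Sum.inr v) 2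
      (((mu K (p ^ M)).tateDualPairing (p ^ M)).cupProduct
        ((isSES_kummer K (p ^ M) (NeZero.pos _)).δ₀ (baseUnitsInvariant K (b : K) b.ne_zero))
        (oneCocycleClass _ (scalarCocycle ψ)))) = 0 := fun v hv => by
    rw [← hb, hy'', localInvariantMap_localization_muInclHom_eq_zero_iff heM v y']
    exact hS' v hv
  -- the cyclic reciprocity law, read back at level `p^e`
  have hsum := sum_localInvariantMap_localization_cupProduct_δ₀_eq_zero_of_isTotallyComplex
    (κ.layer M) ψ hkerL b hram S' hSψ
  rw [← hb, hy'', sum_localInvariantMap_localization_muInclHom_eq_zero_iff heM] at hsum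
  exact hsum

/-- **`(LocalInvariants.canonical K (p^(m+1))).SumInvLocalizationEqZero` for `K` totally complex,
granting the correction at `p`**: the complex places contribute nothing
(`canonical_inl_eq_zero_of_isComplex`), and the finite places are
`sum_localInvariantMap_localization_eq_zero_of_correction`.
[cite: CasselsFrohlichANT1967, Ch. VII §10–§11] [cite: MilneADT2006, Ch. I, Thm. 4.10(b)] -/
theorem sumInvLocalizationEqZero_canonical_primePow_of_correction (m : ℕ)
    (hpre : ∀ (y : galoisCohomology (mu K (p ^ (m + 1))) 2) (S : Finset (HeightOneSpectrum (𝓞 K))),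
      (∀ v ∉ S, localInvariantMap K (p ^ (m + 1)) v
        (galoisCohomology.localization (mu K (p ^ (m + 1))) (Sum.inr v) 2 y) = 0) →
      ∃ e : ℕ, m + 1 ≤ e ∧ ∃ (y' : galoisCohomology (mu K (p ^ e)) 2) (S' : Finset (HeightOneSpectrum (𝓞 K))),
        S ⊆ S' ∧
        (∀ v : HeightOneSpectrum (𝓞 K), (p : 𝓞 K) ∈ v.asIdeal →
          galoisCohomology.localization (mu K (p ^ e)) (Sum.inr v) 2 y' = 0) ∧
        (∀ v ∉ S', localInvariantMap K (p ^ e) v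
          (galoisCohomology.localization (mu K (p ^ e)) (Sum.inr v) 2 y') = 0) ∧
        (∀ T : Finset (HeightOneSpectrum (𝓞 K)), S' ⊆ T →
          ∑ v ∈ T, localInvariantMap K (p ^ e) v (galoisCohomology.localization (mu K (p ^ e)) (Sum.inr v) 2 y') =
            (((∑ v ∈ T, localInvariantMap K (p ^ (m + 1)) v
              (galoisCohomology.localization (mu K (p ^ (m + 1))) (Sum.inr v) 2 y)).val * p ^ (e - m - 1) : ℕ) :
              ZMod (p ^ e)))) :
    (LocalInvariants.canonical K (p ^ (m + 1))).SumInvLocalizationEqZero := by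
  classical
  intro c S hS
  -- the finite places in `S`
  set Sf : Finset (HeightOneSpectrum (𝓞 K)) := S.preimage Sum.inr (Sum.inr_injective.injOn) with hSf
  have hzero : ∀ x ∈ S, x ∉ Set.range (Sum.inr : HeightOneSpectrum (𝓞 K) → Place K) →
      LocalInvariants.canonical K (p ^ (m + 1)) x (galoisCohomology.localization (mu K (p ^ (m + 1))) x 2 c) = 0 := by
    intro x _ hx
    rcases x with w | v
    · exact LocalInvariants.canonical_inl_eq_zero_of_isComplex (IsTotallyComplex.isComplex w) _
    · exact absurd ⟨v, rfl⟩ hx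
  rw [← Finset.sum_preimage Sum.inr S Sum.inr_injective.injOn _ hzero]
  refine sum_localInvariantMap_localization_eq_zero_of_correction K p m hpre c Sf fun v hv => ?_
  have hv' : (Sum.inr v : Place K) ∉ S := by rwa [Finset.mem_preimage] at hv
  exact hS _ hv'

/-! ### All levels, and the named fact, modulo the correction at every prime -/

omit hp in
/-- **`(LocalInvariants.canonical K n).SumInvLocalizationEqZero` for every `n ≥ 1`, `K` totally
complex, granting the correction at every prime** (primary decomposition
`sumInvLocalizationEqZero_canonical_of_primePow` + the prime-power case).
[cite: CasselsFrohlichANT1967, Ch. VII §11] -/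
theorem sumInvLocalizationEqZero_canonical_of_correction
    (hpre : ∀ (p : ℕ) [Fact p.Prime] (m : ℕ) (y : galoisCohomology (mu K (p ^ (m + 1))) 2)
      (S : Finset (HeightOneSpectrum (𝓞 K))),
      (∀ v ∉ S, localInvariantMap K (p ^ (m + 1)) v
        (galoisCohomology.localization (mu K (p ^ (m + 1))) (Sum.inr v) 2 y) = 0) →
      ∃ e : ℕ, m + 1 ≤ e ∧ ∃ (y' : galoisCohomology (mu K (p ^ e)) 2) (S' : Finset (HeightOneSpectrum (𝓞 K))),
        S ⊆ S' ∧
        (∀ v : HeightOneSpectrum (𝓞 K), (p : 𝓞 K) ∈ v.asIdeal →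
          galoisCohomology.localization (mu K (p ^ e)) (Sum.inr v) 2 y' = 0) ∧
        (∀ v ∉ S', localInvariantMap K (p ^ e) v
          (galoisCohomology.localization (mu K (p ^ e)) (Sum.inr v) 2 y') = 0) ∧
        (∀ T : Finset (HeightOneSpectrum (𝓞 K)), S' ⊆ T →
          ∑ v ∈ T, localInvariantMap K (p ^ e) v (galoisCohomology.localization (mu K (p ^ e)) (Sum.inr v) 2 y') =
            (((∑ v ∈ T, localInvariantMap K (p ^ (m + 1)) v
              (galoisCohomology.localization (mu K (p ^ (m + 1))) (Sum.inr v) 2 y)).val * p ^ (e - m - 1) : ℕ) :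
              ZMod (p ^ e))))
    (n : ℕ) [NeZero n] : (LocalInvariants.canonical K n).SumInvLocalizationEqZero := by
  refine sumInvLocalizationEqZero_canonical_of_primePow (fun q _ hq => ?_) n
  obtain ⟨p, k, hpq, hk, rfl⟩ := hq
  haveI : Fact p.Prime := ⟨Nat.prime_iff.mpr hpq⟩
  obtain ⟨m, rfl⟩ : ∃ m, k = m + 1 := ⟨k - 1, by omega⟩
  exact sumInvLocalizationEqZero_canonical_primePow_of_correction K p m (hpre p m)

omit hp in
/-- **Poitou–Tate (as vendored, `poitouTate_sum_localTatePairing_eq_zero K`) for a totally complex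
number field `K`, granting the correction at every prime** — through THE invariant maps
(`poitouTate_sum_localTatePairing_eq_zero_of_canonical`).  The remaining input is the statement of
`BrauerClassCorrectionAtP.lean` (Tate VII §11, auxiliary `K(ζ_q)`-classes).
[cite: MilneADT2006, Ch. I, Thm. 4.10(b)] [cite: CasselsFrohlichANT1967, Ch. VII §11] -/
theorem poitouTate_sum_localTatePairing_eq_zero_of_isTotallyComplex_of_correction
    (hpre : ∀ (p : ℕ) [Fact p.Prime] (m : ℕ) (y : galoisCohomology (mu K (p ^ (m + 1))) 2)
      (S : Finset (HeightOneSpectrum (𝓞 K))),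
      (∀ v ∉ S, localInvariantMap K (p ^ (m + 1)) v
        (galoisCohomology.localization (mu K (p ^ (m + 1))) (Sum.inr v) 2 y) = 0) →
      ∃ e : ℕ, m + 1 ≤ e ∧ ∃ (y' : galoisCohomology (mu K (p ^ e)) 2) (S' : Finset (HeightOneSpectrum (𝓞 K))),
        S ⊆ S' ∧
        (∀ v : HeightOneSpectrum (𝓞 K), (p : 𝓞 K) ∈ v.asIdeal →
          galoisCohomology.localization (mu K (p ^ e)) (Sum.inr v) 2 y' = 0) ∧
        (∀ v ∉ S', localInvariantMap K (p ^ e) v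
          (galoisCohomology.localization (mu K (p ^ e)) (Sum.inr v) 2 y') = 0) ∧
        (∀ T : Finset (HeightOneSpectrum (𝓞 K)), S' ⊆ T →
          ∑ v ∈ T, localInvariantMap K (p ^ e) v (galoisCohomology.localization (mu K (p ^ e)) (Sum.inr v) 2 y') =
            (((∑ v ∈ T, localInvariantMap K (p ^ (m + 1)) v
              (galoisCohomology.localization (mu K (p ^ (m + 1))) (Sum.inr v) 2 y)).val * p ^ (e - m - 1) : ℕ) :
              ZMod (p ^ e)))) :
    poitouTate_sum_localTatePairing_eq_zero K :=
  poitouTate_sum_localTatePairing_eq_zero_of_canonical fun n _ =>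
    sumInvLocalizationEqZero_canonical_of_correction K hpre n

end Literature.NumberTheory.GaloisCohomology

end
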